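/-
Chen 2024 (IACR ePrint 2024/555, version of 2024-04-18), §3.5.9 (9.e)–(9.h) pp. 37–38: the law of eq. (41)
when coordinate 1 is processed by an arbitrary INSTRUMENT (intermediate measurements with classical
records and record-dependent further processing) before the final `QFT` — exactly `Pr[p₁ ∣ u₁]/Q ≤ 1/Q`.

HONEST FRAMING: the VALUE is a THEOREM / DECIDABLE VERDICT / CERTIFICATE / precise negative result — NOT
summit progress.  Theorems about a WITHDRAWN algorithm; nothing is repaired, nothing is broken, no
cryptanalytic claim.  No named fact is introduced (debt 0).
-/
import Literature.Computability.Cryptography.ChenQuantumLWEPlantedSlots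

/-!
# Chen 2024, Step 9 under an arbitrary coordinate-1 instrument: `Pr[(41)] = Pr[p₁ ∣ u₁]/Q`

Chen's (9.f) (p. 37) is itself a measurement inside Step 9: "measure out the first coordinate modulo
`p₂⋯p_κ`, which will return `0`, and then we interpret the remaining first coordinate as being divided by
`p₂⋯p_κ`"; (9.g) is a phase kickback and (9.h) the final `QFT_{ℤ_N^{n+1}}` and measurement.  The tree decides
eq. (41) for every LINEAR processing `K` of coordinate 1 (`ChenQuantumLWEEq41Exact.prob_eq41_eq`:
`Pr_K[(41)] = Pr_K[p₁ ∣ u₁]/Q`; `ChenQuantumLWEStepNineVerdict.step9_verdict`; the Bezout hypothesis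
discharged in `ChenQuantumLWEPlantedSlots`).  One kernel models ONE branch of an intermediate measurement.
This module closes the class under CLASSICAL CONTROL: a general quantum instrument on coordinate 1 —
any finite sequence of measurements of coordinate 1 with classical records, each followed by
record-dependent linear processing of coordinate 1, adaptively — has, once the record sequence `a ∈ α` is
fixed, an overall Kraus kernel `K a` on coordinate 1, and the joint unnormalised Born weight of
(record `a`, final outcome `u`) is `‖QFT(processed (K a))(u)‖²`.  The statements below are about an
ARBITRARY finite family `K : α → kernel` and the RATIO law it defines (`0/0 = 0`), so they need no
trace-preservation hypothesis and also cover post-selected protocols.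

RESULTS (`S` an admissible shape; `Pl : S.Planted` = eq. (39)'s planted slots, or an explicit Bezout
witness `(w, hw)`):
* `weightI_eq_public` — the joint weight of `(a, u)` is `Q · headWeight(D, p₁, Q, K a, u₁)`: PUBLIC (no
  `b, v′, b*, v*`) and uniform in `u[2..n+1]` (from `born_weight_eq`);
* `weightI_instance_indep`, `lawI_instance_indep` — two admissible instances with the same `(n, D, p₁, Q)`
  have identical joint laws of (record, outcome) for every instrument: the whole transcript of Step 9 is
  secret-independent (from `born_weight_instance_indep`);
* `sum_weightI_eq41_mul` — `Q · W[(41)] = W[p₁ ∣ u₁]` summed over records (from `weight_eq41_mul`);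
* **`probEq41I_eq`** — `Pr_I[(41)] = Pr_I[p₁ ∣ u₁]/Q` for every instrument `I = (K a)_a`;
* **`probEq41I_le`** — `Pr_I[(41)] ≤ 1/Q`, with NO non-degeneracy hypothesis;
* `probEq41I_unit` — a one-record instrument is a kernel: `probEq41I (fun _ : Unit ↦ K) = probEq41 K`;
* `probEq41I_eq_planted`, `probEq41I_le_planted`, **`step9_instrument_verdict`** — the same with the
  Bezout hypothesis discharged by the planted slots.
So no classical control on coordinate 1 — in particular no outcome of the measurement in (9.f), and no
outcome-dependent repair of (9.g) — changes the verdict of Lemma 3.8: eq. (41) is never certain; it holds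
with probability at most `1/Q`.
[cite: ChenQuantumLattice2024, §3.5.9 (9.e)–(9.h) pp. 37–38, eq. (41) p. 38, eq. (39) p. 36;
NielsenChuang2010, §2.2.3–§2.2.6 pp. 84–90 and §8.2.3 pp. 360–366]
-/

namespace Literature.Computability.Cryptography.Chen2024

open Finset

namespace Shape

variable (S : Shape) {α : Type*} [Fintype α]

/-- Joint unnormalised Born weight of (record `a`, final outcome `u`) for the instrument with branch
kernels `K a` on coordinate 1, followed by `QFT_{ℤ_N^{n+1}}`.
[cite: ChenQuantumLattice2024, §3.5.9 (9.e)–(9.h) pp. 37–38; NielsenChuang2010, §8.2.3 p. 360] -/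
noncomputable def weightI (K : α → ZMod S.N → ZMod S.N → ℂ) (a : α) (u : Fin (S.n + 1) → ZMod S.N) : ℝ :=
  ‖qft (S.processed (K a)) u‖ ^ 2

/-- Total weight of the instrument (`= ‖φ8.f‖²` for a trace-preserving instrument; arbitrary here).
[cite: NielsenChuang2010, §8.2.3 p. 360] -/
noncomputable def totalI (K : α → ZMod S.N → ZMod S.N → ℂ) : ℝ := ∑ a, ∑ u, S.weightI K a u

/-- The joint law `Pr_I[a, u]` (ratio; `0/0 = 0`). [cite: NielsenChuang2010, §2.2.3 p. 84, §8.2.3 p. 360] -/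
noncomputable def lawI (K : α → ZMod S.N → ZMod S.N → ℂ) (a : α) (u : Fin (S.n + 1) → ZMod S.N) : ℝ :=
  S.weightI K a u / S.totalI K

/-- `Pr_I[(41)]`: probability that the final outcome satisfies eq. (41), records summed out.
[cite: ChenQuantumLattice2024, eq. (41) p. 38] -/
noncomputable def probEq41I [DecidablePred S.eq41] (K : α → ZMod S.N → ZMod S.N → ℂ) : ℝ :=
  (∑ a, ∑ u ∈ univ.filter S.eq41, S.weightI K a u) / S.totalI K

/-- `Pr_I[p₁ ∣ u₁]`: probability that coordinate 1 of the final outcome is a multiple of `p₁`.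
[cite: ChenQuantumLattice2024, §3.5.9 (9.h) p. 38] -/
noncomputable def probHeadDvdI (K : α → ZMod S.N → ZMod S.N → ℂ) : ℝ :=
  (∑ a, ∑ u ∈ univ.filter (fun u : Fin (S.n + 1) → ZMod S.N => (S.p₁ : ℕ) ∣ (u 0).val),
      S.weightI K a u) / S.totalI K

variable (K : α → ZMod S.N → ZMod S.N → ℂ)

omit [Fintype α] in
/-- Born weights are non-negative. [cite: NielsenChuang2010, §2.2.3 p. 84] -/
theorem weightI_nonneg (a : α) (u : Fin (S.n + 1) → ZMod S.N) : 0 ≤ S.weightI K a u := by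
  unfold weightI; positivity

/-- The total weight is non-negative. [cite: NielsenChuang2010, §2.2.3 p. 84, §8.2.3 p. 360] -/
theorem totalI_nonneg : 0 ≤ S.totalI K :=
  sum_nonneg fun a _ => sum_nonneg fun u _ => S.weightI_nonneg K a u

omit [Fintype α] in
/-- **The joint weight is public and flat in the tail**: `W_I(a, u) = headWeight(D, p₁, Q, K a, u₁) · Q` —
none of `b, v′, b*, v*` and none of `u[2..n+1]` occurs.
[cite: ChenQuantumLattice2024, §3.5.9 (9.h) p. 38, Lemma 2.12 p. 12] -/
theorem weightI_eq_public (h : S.Admissible) (a : α) (u : Fin (S.n + 1) → ZMod S.N) :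
    S.weightI K a u = headWeight S.D S.p₁ S.Q (K a) (u 0) * S.Q := by
  have e := S.born_weight_eq h (K a) (u 0) (Fin.tail u)
  rw [Fin.cons_self_tail] at e
  exact e

omit [Fintype α] in
/-- **Secret independence of the whole transcript**: two admissible instances with the same public
parameters have the same joint weights (record, outcome), for every instrument.
[cite: ChenQuantumLattice2024, §3.5.9 pp. 34–38, eq. (12) p. 17] -/
theorem weightI_instance_indep (h : S.Admissible) {b₂ v₂ c₂ w₂ : Fin (S.n + 1) → ℤ}
    (h₂ : (S.withVectors b₂ v₂ c₂ w₂).Admissible) (a : α) (u : Fin (S.n + 1) → ZMod S.N) :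
    (S.withVectors b₂ v₂ c₂ w₂).weightI K a u = S.weightI K a u :=
  S.born_weight_instance_indep h h₂ (K a) u

/-- Hence identical joint LAWS of (record, outcome) across instances.
[cite: ChenQuantumLattice2024, §3.5.9 pp. 34–38] -/
theorem lawI_instance_indep (h : S.Admissible) {b₂ v₂ c₂ w₂ : Fin (S.n + 1) → ℤ}
    (h₂ : (S.withVectors b₂ v₂ c₂ w₂).Admissible) (a : α) (u : Fin (S.n + 1) → ZMod S.N) :
    (S.withVectors b₂ v₂ c₂ w₂).lawI K a u = S.lawI K a u := by
  have hW : (S.withVectors b₂ v₂ c₂ w₂).weightI K = S.weightI K :=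
    funext fun a => funext fun u => S.weightI_instance_indep K h h₂ a u
  unfold lawI totalI
  rw [hW]
  rfl

/-- `Q · W_I[(41)] = W_I[p₁ ∣ u₁]` (records summed): the per-branch identity `weight_eq41_mul`, summed.
[cite: ChenQuantumLattice2024, eq. (41) p. 38] -/
theorem sum_weightI_eq41_mul (h : S.Admissible) [DecidablePred S.eq41]
    (w : Fin S.n → ℤ) (hw : ((∑ t, w t * S.bstar (Fin.succ t) : ℤ) : ZMod S.Q) = 1) :
    (∑ a, ∑ u ∈ univ.filter S.eq41, S.weightI K a u) * S.Q
      = ∑ a, ∑ u ∈ univ.filter (fun u : Fin (S.n + 1) → ZMod S.N => (S.p₁ : ℕ) ∣ (u 0).val),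
          S.weightI K a u := by
  rw [sum_mul]
  exact sum_congr rfl fun a _ => S.weight_eq41_mul h (K a) w hw

/-- **`Pr_I[(41)] = Pr_I[p₁ ∣ u₁] / Q` for every coordinate-1 instrument** (Bezout witness explicit).
[cite: ChenQuantumLattice2024, §3.5.9 (9.e)–(9.h) pp. 37–38, eq. (41) p. 38] -/
theorem probEq41I_eq (h : S.Admissible) [DecidablePred S.eq41]
    (w : Fin S.n → ℤ) (hw : ((∑ t, w t * S.bstar (Fin.succ t) : ℤ) : ZMod S.Q) = 1) :
    S.probEq41I K = S.probHeadDvdI K / S.Q := by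
  have hQ : ((S.Q : ℕ) : ℝ) ≠ 0 := by exact_mod_cast S.Q.ne_zero
  unfold probEq41I probHeadDvdI
  rw [← S.sum_weightI_eq41_mul K h w hw, div_div, mul_comm (S.totalI K), ← div_div,
    mul_div_cancel_right₀ _ hQ]

/-- `0 ≤ Pr_I[p₁ ∣ u₁]`. [cite: NielsenChuang2010, §2.2.3 p. 84] -/
theorem probHeadDvdI_nonneg : 0 ≤ S.probHeadDvdI K :=
  div_nonneg (sum_nonneg fun a _ => sum_nonneg fun u _ => S.weightI_nonneg K a u) (S.totalI_nonneg K)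

/-- `Pr_I[p₁ ∣ u₁] ≤ 1`. [cite: NielsenChuang2010, §2.2.3 p. 84] -/
theorem probHeadDvdI_le_one : S.probHeadDvdI K ≤ 1 := by
  unfold probHeadDvdI
  have hle : (∑ a, ∑ u ∈ univ.filter (fun u : Fin (S.n + 1) → ZMod S.N => (S.p₁ : ℕ) ∣ (u 0).val),
      S.weightI K a u) ≤ S.totalI K :=
    sum_le_sum fun a _ =>
      sum_le_sum_of_subset_of_nonneg (filter_subset _ _) fun u _ _ => S.weightI_nonneg K a u
  rcases (S.totalI_nonneg K).eq_or_lt with h0 | hpos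
  · rw [← h0, div_zero]; exact zero_le_one
  · exact (div_le_one hpos).2 hle

/-- **`Pr_I[(41)] ≤ 1/Q` for every coordinate-1 instrument** — no non-degeneracy hypothesis (on the
degenerate branch both sides of `probEq41I_eq` are `0`).  Lemma 3.8 asserted probability `1`.
[cite: ChenQuantumLattice2024, Lemma 3.8 p. 21, eq. (41) p. 38] -/
theorem probEq41I_le (h : S.Admissible) [DecidablePred S.eq41]
    (w : Fin S.n → ℤ) (hw : ((∑ t, w t * S.bstar (Fin.succ t) : ℤ) : ZMod S.Q) = 1) :
    S.probEq41I K ≤ 1 / S.Q := by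
  rw [S.probEq41I_eq K h w hw]
  have hQ : (0 : ℝ) < ((S.Q : ℕ) : ℝ) := by exact_mod_cast S.Q.pos
  exact div_le_div_of_nonneg_right (S.probHeadDvdI_le_one K) hQ.le

/-- A one-record instrument is a kernel: consistency with `ChenQuantumLWEStepNineVerdict.probEq41`.
[cite: ChenQuantumLattice2024, §3.5.9 (9.e)–(9.h) pp. 37–38] -/
theorem probEq41I_unit [DecidablePred S.eq41] (K₀ : ZMod S.N → ZMod S.N → ℂ) :
    S.probEq41I (fun _ : Unit => K₀) = S.probEq41 K₀ := by
  simp [probEq41I, probEq41, totalI, weightI]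

/-- The same identity with the Bezout hypothesis discharged by eq. (39)'s planted slots.
[cite: ChenQuantumLattice2024, eq. (39) p. 36, eq. (41) p. 38] -/
theorem probEq41I_eq_planted (h : S.Admissible) [DecidablePred S.eq41] (Pl : S.Planted) :
    S.probEq41I K = S.probHeadDvdI K / S.Q := by
  obtain ⟨w, hw⟩ := S.exists_bezout_planted h Pl
  exact S.probEq41I_eq K h w hw

/-- `Pr_I[(41)] ≤ 1/Q`, Bezout hypothesis discharged. [cite: ChenQuantumLattice2024, eq. (39) p. 36, eq. (41) p. 38] -/
theorem probEq41I_le_planted (h : S.Admissible) [DecidablePred S.eq41] (Pl : S.Planted) :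
    S.probEq41I K ≤ 1 / S.Q := by
  obtain ⟨w, hw⟩ := S.exists_bezout_planted h Pl
  exact S.probEq41I_le K h w hw

/-- **Step 9 under classical control, decided.**  For an admissible shape with eq. (39)'s planted slots and
EVERY finite instrument `K : α → kernel` on coordinate 1 (records `a`, adaptively processed branches),
followed by the final `QFT` and measurement: (1) the joint weight of (record, outcome) is the public number
`Q · headWeight(D, p₁, Q, K a, u₁)`; (2) it is the same for every admissible instance with the same public
parameters (the transcript is secret-independent); (3) `Pr_I[(41)] = Pr_I[p₁ ∣ u₁]/Q`; (4) `Pr_I[(41)] ≤ 1/Q`.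
[cite: ChenQuantumLattice2024, §3.5.9 pp. 34–38, Lemma 3.8 p. 21, eq. (39) p. 36, eq. (41) p. 38] -/
theorem step9_instrument_verdict (h : S.Admissible) [DecidablePred S.eq41] (Pl : S.Planted) :
    (∀ (a : α) (u : Fin (S.n + 1) → ZMod S.N),
        S.weightI K a u = headWeight S.D S.p₁ S.Q (K a) (u 0) * S.Q) ∧
    (∀ (b₂ v₂ c₂ w₂ : Fin (S.n + 1) → ℤ), (S.withVectors b₂ v₂ c₂ w₂).Admissible →
        ∀ (a : α) (u : Fin (S.n + 1) → ZMod S.N), (S.withVectors b₂ v₂ c₂ w₂).lawI K a u = S.lawI K a u) ∧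
    S.probEq41I K = S.probHeadDvdI K / S.Q ∧
    S.probEq41I K ≤ 1 / S.Q :=
  ⟨fun a u => S.weightI_eq_public K h a u, fun _ _ _ _ h₂ a u => S.lawI_instance_indep K h h₂ a u,
    S.probEq41I_eq_planted K h Pl, S.probEq41I_le_planted K h Pl⟩

end Shape

end Literature.Computability.Cryptography.Chen2024
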